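import Summits.CriticalPhenomena.PercolationContinuityZ3.Theorems.PercNearOneGluingAdditiveGluingFingerPeel
import Literature.Probability.LatticeModels.ProdBernoulliIndependence
import HarnessLib

/-! # Crux `PercNearOneGluing.AdditiveGluing` (stmt-CriticalPhenomena-4576) — the finger multi-edge Lemma 3 (`stub_fingerML3_vp`):
# peeling ONE finger–relay PAIR (seat (b) V⁺-form, depth prover `png-dp-vplus`, gen 6)

Support file (`--supports stmt-CriticalPhenomena-4576`); no definitions, no named facts, no sorries.  Companion of
`…AdditiveGluingFingerPeel.lean` (`fingerML3_peel`: peeling ALL pairs at one relay) and `…AdditiveGluingBlockPeel.lean`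
(`block_multiEdge_peel`, which already allows any sub-family of the pairs at one relay).

* `fingerML3_peel_pair` — **the induction step on the number of finger–relay pairs.**  Stub setting (`K`, relays `A ∋ b, d`, block `N`,
  `Disjoint N A`), a relay `a ≠ d` and a finger `f ∈ N`.  If `μ_K(d↔b) ≤ μ_K(a↔b)` (the stub's unglued hypothesis at the single relay `a`, read in
  the CURRENT weighting) and the conclusion of the stub holds for the SAME relay set `A` in the weighting `K ⊖ s(f,a)` (the one pair killed), then
  it holds for `K`.  In the notation of memo MEMO-gen6 §5 (run/shared/lean/prim/prim-png-dp-vplus/): `margin_K(d) = p·G + (1−p)·margin_{K⊖e}(d)`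
  with `G ≥ 0` by Kozma–Nitzan Lemma 3(ii) — this file is the inequality form `margin_{K⊖e}(d) ≥ 0 ⇒ margin_K(d) ≥ 0`.
* `contact_event_erase_null_pair` — dropping a weight-`0` pair from the contact event does not change probabilities (used to read the
  hypothesis on `K ⊖ e` with the stub's own contact event, which still lists the killed pair).
Iterating `fingerML3_peel_pair` along any order of the pairs reduces the stub to the hypothesis transfers studied in the memo (one-step claim:
after killing a suitable pair, `d` is still unglued-weakest, or is `ρs`-dominated by the new weakest / base-weakest contact —
`fingerML3_transfer_relay`).
[cite: KozmaNitzan2024, Lemma 3(i)–(ii) (pp. 6–7), Lemma 5 and Thm 4 (§3.2, pp. 12–14)]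
-/

namespace Summit.CriticalPhenomena.PercolationContinuityZ3.Theorems

open MeasureTheory Set
open Literature.Probability.LatticeModels (prodBernoulli)
open Literature.Probability.Percolation (BondConfig openConn openGraph pinW)

noncomputable section
open Classical

section FingerPeelPair

open Literature.Probability.LatticeModels Literature.Probability.Percolation

variable {n : ℕ}

/-- A pair of weight `0` may be dropped from a contact event: `μ((∃ e ∈ insert e₀ F, e ∈ ω) ∩ E) = μ((∃ e ∈ F, e ∈ ω) ∩ E)` when
`w e₀ = 0`. [folklore] -/
theorem contact_event_erase_null_pair (w : Sym2 (Fin n) → unitInterval) (F : Finset (Sym2 (Fin n))) (e₀ : Sym2 (Fin n))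
    (h0 : (w e₀ : ℝ) = 0) (E : Set (BondConfig (Fin n))) :
    (prodBernoulli w).real ({ω : Set (Sym2 (Fin n)) | ∃ e ∈ insert e₀ F, e ∈ ω} ∩ E) =
      (prodBernoulli w).real ({ω : Set (Sym2 (Fin n)) | ∃ e ∈ F, e ∈ ω} ∩ E) := by
  have hnull : (prodBernoulli w).real {ω : Set (Sym2 (Fin n)) | e₀ ∈ ω} = 0 := by
    rw [prodBernoulli_real_setOf_mem]; exact h0
  apply le_antisymm
  · have hsub : ({ω : Set (Sym2 (Fin n)) | ∃ e ∈ insert e₀ F, e ∈ ω} ∩ E : Set (BondConfig (Fin n))) ⊆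
        ({ω : Set (Sym2 (Fin n)) | ∃ e ∈ F, e ∈ ω} ∩ E) ∪ {ω : Set (Sym2 (Fin n)) | e₀ ∈ ω} := by
      rintro ω ⟨⟨e, he, heω⟩, hE⟩
      rcases Finset.mem_insert.1 he with rfl | he'
      · exact Or.inr heω
      · exact Or.inl ⟨⟨e, he', heω⟩, hE⟩
    calc (prodBernoulli w).real ({ω : Set (Sym2 (Fin n)) | ∃ e ∈ insert e₀ F, e ∈ ω} ∩ E)
        ≤ (prodBernoulli w).real (({ω : Set (Sym2 (Fin n)) | ∃ e ∈ F, e ∈ ω} ∩ E) ∪ {ω : Set (Sym2 (Fin n)) | e₀ ∈ ω}) :=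
          measureReal_mono hsub (measure_ne_top _ _)
      _ ≤ (prodBernoulli w).real ({ω : Set (Sym2 (Fin n)) | ∃ e ∈ F, e ∈ ω} ∩ E) +
            (prodBernoulli w).real {ω : Set (Sym2 (Fin n)) | e₀ ∈ ω} := measureReal_union_le _ _
      _ = (prodBernoulli w).real ({ω : Set (Sym2 (Fin n)) | ∃ e ∈ F, e ∈ ω} ∩ E) := by rw [hnull, add_zero]
  · refine measureReal_mono ?_ (measure_ne_top _ _)
    rintro ω ⟨⟨e, he, heω⟩, hE⟩
    exact ⟨⟨e, Finset.mem_insert_of_mem he, heω⟩, hE⟩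

/-- Killing one finger–relay pair in the glued weighting is gluing the weighting with that pair killed (`a ∉ N`). [folklore] -/
theorem fingerPeelPair_pinW_glue_eq (K : Sym2 (Fin n) → unitInterval) (N : Finset (Fin n)) {f a : Fin n} (haN : a ∉ N) :
    pinW (fun e' : Sym2 (Fin n) => if (∀ y ∈ e', y ∈ N) ∧ ¬ e'.IsDiag then 1 else K e')
        (↑({s(f, a)} : Finset (Sym2 (Fin n))) : Set (Sym2 (Fin n))) (∅ : Set (Sym2 (Fin n))) =
      fun e' : Sym2 (Fin n) => if (∀ y ∈ e', y ∈ N) ∧ ¬ e'.IsDiag then 1 else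
        if e' = s(f, a) then (0 : unitInterval) else K e' := by
  funext e
  by_cases he : e = s(f, a)
  · subst he
    have hmem : s(f, a) ∈ (↑({s(f, a)} : Finset (Sym2 (Fin n))) : Set (Sym2 (Fin n))) := by simp
    rw [pinW_apply_of_mem_of_not_mem _ hmem (Set.notMem_empty _)]
    have h1 : ¬ ((∀ y ∈ s(f, a), y ∈ N) ∧ ¬ (s(f, a)).IsDiag) := fun h => haN (h.1 a (Sym2.mem_mk_right f a))
    simp only [h1, if_false, if_true]
  · have hnm : e ∉ (↑({s(f, a)} : Finset (Sym2 (Fin n))) : Set (Sym2 (Fin n))) := by simpa using he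
    rw [pinW_apply_of_not_mem _ _ hnm]
    simp only [he, if_false]

/-- **Peeling one finger–relay pair.**  Stub setting with `d, a ∈ A`, `a ≠ d`, `f ∈ N`.  If `μ_K(d ↔ b) ≤ μ_K(a ↔ b)` (unglued, in `K`)
and the conclusion of `stub_fingerML3_vp` holds for the relay set `A` in the weighting `K ⊖ s(f,a)` (the pair `s(f,a)` killed), then it
holds for `A` in `K`.  (`glue_restricted_of_unglued` + `block_multiEdge_peel` with the one-pair family `{s(f,a)}`.)
[cite: KozmaNitzan2024, Lemma 3(i)–(ii) (pp. 6–7), §3.2 pp. 12–14] -/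
theorem fingerML3_peel_pair (K : Sym2 (Fin n) → unitInterval) (A N : Finset (Fin n)) (d a b f : Fin n)
    (hNA : Disjoint N A) (hd : d ∈ A) (ha : a ∈ A) (hda : d ≠ a) (hf : f ∈ N)
    (hle : (prodBernoulli K).real (openConn d b) ≤ (prodBernoulli K).real (openConn a b))
    (hsub : (prodBernoulli (fun e' : Sym2 (Fin n) => if (∀ y ∈ e', y ∈ N) ∧ ¬ e'.IsDiag then 1 else
              if e' = s(f, a) then (0 : unitInterval) else K e')).real
          ({ω : Set (Sym2 (Fin n)) | ∃ v ∈ N, ∃ a' ∈ A, s(v, a') ∈ ω} ∩ openConn d b) ≤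
        (prodBernoulli (fun e' : Sym2 (Fin n) => if (∀ y ∈ e', y ∈ N) ∧ ¬ e'.IsDiag then 1 else
              if e' = s(f, a) then (0 : unitInterval) else K e')).real
          ({ω : Set (Sym2 (Fin n)) | ∃ v ∈ N, ∃ a' ∈ A, s(v, a') ∈ ω} ∩ ⋃ v ∈ N, openConn v b)) :
    (prodBernoulli (fun e' : Sym2 (Fin n) => if (∀ y ∈ e', y ∈ N) ∧ ¬ e'.IsDiag then 1 else K e')).real
        ({ω : Set (Sym2 (Fin n)) | ∃ v ∈ N, ∃ a' ∈ A, s(v, a') ∈ ω} ∩ openConn d b) ≤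
      (prodBernoulli (fun e' : Sym2 (Fin n) => if (∀ y ∈ e', y ∈ N) ∧ ¬ e'.IsDiag then 1 else K e')).real
        ({ω : Set (Sym2 (Fin n)) | ∃ v ∈ N, ∃ a' ∈ A, s(v, a') ∈ ω} ∩ ⋃ v ∈ N, openConn v b) := by
  set g : Sym2 (Fin n) → unitInterval := fun e' => if (∀ y ∈ e', y ∈ N) ∧ ¬ e'.IsDiag then 1 else K e' with hg
  set g' : Sym2 (Fin n) → unitInterval := fun e' => if (∀ y ∈ e', y ∈ N) ∧ ¬ e'.IsDiag then 1 else
      if e' = s(f, a) then (0 : unitInterval) else K e' with hg'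
  set Fa : Finset (Sym2 (Fin n)) := {s(f, a)} with hFadef
  set Fall : Finset (Sym2 (Fin n)) := (N ×ˢ A).image (fun va : Fin n × Fin n => s(va.1, va.2)) with hFalldef
  set F₁ : Finset (Sym2 (Fin n)) := Fall.erase s(f, a) with hF₁def
  have haN : a ∉ N := Finset.disjoint_left.1 hNA.symm ha
  have hdN : d ∉ N := Finset.disjoint_left.1 hNA.symm hd
  have hFa : ∀ e ∈ Fa, ∃ v ∈ N, e = s(v, a) := by
    intro e he
    rw [hFadef, Finset.mem_singleton] at he
    exact ⟨f, hf, he⟩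
  have hmemall : s(f, a) ∈ Fall := Finset.mem_image.2 ⟨(f, a), Finset.mem_product.2 ⟨hf, ha⟩, rfl⟩
  have hunion : F₁ ∪ Fa = Fall := by
    rw [hF₁def, hFadef, Finset.union_comm, ← Finset.insert_eq]
    exact Finset.insert_erase hmemall
  have hinsert : insert s(f, a) F₁ = Fall := by rw [hF₁def]; exact Finset.insert_erase hmemall
  have hrestr := glue_restricted_of_unglued K N d a b hle
  have hpin : pinW g (↑Fa : Set (Sym2 (Fin n))) (∅ : Set (Sym2 (Fin n))) = g' := by
    rw [hg, hg', hFadef]; exact fingerPeelPair_pinW_glue_eq K N haN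
  -- the killed pair has weight 0 in `g'`
  have h0 : (g' s(f, a) : ℝ) = 0 := by
    have h1 : ¬ ((∀ y ∈ s(f, a), y ∈ N) ∧ ¬ (s(f, a)).IsDiag) := fun h => haN (h.1 a (Sym2.mem_mk_right f a))
    simp only [hg', h1, if_false, if_true]
    rfl
  have hii : (prodBernoulli (pinW g (↑Fa : Set (Sym2 (Fin n))) (∅ : Set (Sym2 (Fin n))))).real
        ({ω : Set (Sym2 (Fin n)) | ∃ e ∈ F₁, e ∈ ω} ∩ openConn d b) ≤
      (prodBernoulli (pinW g (↑Fa : Set (Sym2 (Fin n))) (∅ : Set (Sym2 (Fin n))))).real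
        ({ω : Set (Sym2 (Fin n)) | ∃ e ∈ F₁, e ∈ ω} ∩ ⋃ s ∈ N, openConn s b) := by
    rw [hpin, ← contact_event_erase_null_pair g' F₁ s(f, a) h0, ← contact_event_erase_null_pair g' F₁ s(f, a) h0, hinsert,
      hFalldef, ← fingerContact_R_eq N A]
    exact hsub
  rw [fingerContact_R_eq N A, ← hFalldef, ← hunion]
  exact block_multiEdge_peel g N F₁ Fa a d b hFa haN hdN hda hrestr hii

end FingerPeelPair

end

end Summit.CriticalPhenomena.PercolationContinuityZ3.Theorems
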